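import Literature.Computability.AlgebraicComplexity.ConstituentStageStructure
import Literature.Computability.AlgebraicComplexity.HashedZeroOutHoles
import Literature.Computability.AlgebraicComplexity.GlobalStageCompatCount
import HarnessLib

/-!
# `p_comp` one level down: Def. 6.12 is well posed and Claim 6.13 as an exact double count
(Vassilevska Williams–Xu–Xu–Zhou 2024, §6.6: Def. 6.12, Claim 6.13, Claim 6.15) — proved

Topic `Literature/Computability/AlgebraicComplexity`.  §6.6 of Vassilevska Williams–Xu–Xu–Zhou,
*New bounds for matrix multiplication: from alpha to omega* (SODA 2024, arXiv:2307.07970):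

> **Definition 6.12 (`p_comp`).** For fixed `Z_K̂` and `Z_K` where `Z_K̂ ∈ Z_K` and `K̂` has level-`ℓ`
> complete split distributions `{ξ_{Z,t}}`, `p*_comp({ξ_{Z,t}})` is the probability that a uniformly
> random block triple consistent with `{α_t}` is compatible with `Z_K̂` … By symmetry between level-`ℓ`
> positions, this probability is the same for different `K̂` that have the same complete split
> distributions, so `p*_comp` and `p_comp` is well-defined.
> **Claim 6.13** [proof]: "it suffices to compute the following two quantities, and `p*_comp` will be
> the ratio between them … We dropped the condition of having correct level-`ℓ` complete split
> distributions and got an overestimation."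

This file PROVES the "by symmetry" steps and the resulting exact inequality for the data
`D : ConstituentRegion c n s M` of one region (`ConstituentStageStructure.lean`), the symmetries being
the chunk permutations within the level-`ℓ` terms acting on both halves of every chunk
(`ConstituentStageUniverse.lean`):

* equivariance of the classes `S_{t,i',j',k'}`, `S_{t,*,*,k'}`, of usefulness (Def. 6.11),
  typicalness and compatibility (Def. 6.9), of `{α_t}`-consistency;
* `exists_chunkSymm_permTriple_eq` — **the symmetries act transitively on the `{α_t}`-consistent
  triples** (their left split-type words have the prescribed counts), hence `compatCount_eq` — the
  number `C` of level-1 `Z`-blocks compatible with a consistent triple does not depend on it;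
* `shapeClass K̂` (the `K̂'` with the same level-`ℓ` complete split distributions `{ξ_{Z,t}}` on every
  term), `card_compatTriples_eq_of_mem_shapeClass` — **Def. 6.12 is well posed**: the number `V(K̂)` of
  consistent triples through `Z_K` compatible with `K̂` only depends on `{ξ_{Z,t}}`;
* `card_compatTriples_mul_card_shapeClass_le` — **Claim 6.13 as a double count**:
  `V(K̂) · #{K̂' : ξ(K̂') = ξ(K̂)} ≤ numalpha · C` (the printed ratio of the two quantities, with the
  over-estimation of the numerator);
* `card_holePairsIn_le`, `card_holePairsIn_mul_le` — consequently the second-type hole count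
  `U_A(T) = |holePairsIn A T|` of `HashedZeroOutHoles.lean` satisfies `U_A(T) · m ≤ M_Z(T) · numalpha · C`
  whenever every relevant useful `K̂` has `#{K̂' : ξ(K̂') = ξ(K̂)} ≥ m` (Claim 6.15's proof).

Everything is proved; the definitions are the counted sets; no named facts.  The product / entropy
formulas for `C`, `#{K̂' : ξ}`, `numalpha` (`λ_{Z,t}`, `H(ξ_{Z,t})`, `H(α_t)`) are not part of this file.

## References

* V. Vassilevska Williams, Y. Xu, Z. Xu, R. Zhou, *New bounds for matrix multiplication: from alpha
  to omega*, SODA 2024, arXiv:2307.07970 (held: `paper:arxiv-2307.07970`), §6.6: Def. 6.12,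
  Claim 6.13 and its proof, Claim 6.15. [VassilevskaWilliamsXuXuZhou2024]
-/

noncomputable section

open scoped BigOperators
open Finset

namespace Literature.Computability.AlgebraicComplexity

/-! ## Equivariance under the chunk symmetries acting on both halves -/

section Equivariance

variable {c n s : ℕ} (τ : Fin n → Fin s)

omit τ in
/-- The chunk of a permuted half-chunk position. [folklore] -/
theorem chunkOf_doublePerm (σ : Equiv.Perm (Fin n)) (p : Fin (n + n)) : chunkOf (doublePerm σ p) = σ (chunkOf p) := by
  refine Fin.addCases (motive := fun p => chunkOf (doublePerm σ p) = σ (chunkOf p)) (fun u => ?_) (fun u => ?_) p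
  · rw [doublePerm_castAdd, chunkOf_castAdd, chunkOf_castAdd]
  · rw [doublePerm_natAdd, chunkOf_natAdd, chunkOf_natAdd]

/-- A chunk symmetry preserves the term of a half-chunk position. [folklore] -/
theorem halfTermOf_doublePerm_symm {σ : Equiv.Perm (Fin n)} (hσ : σ ∈ chunkSymmetries τ) (p : Fin (n + n)) :
    halfTermOf τ ((doublePerm σ).symm p) = halfTermOf τ p := by
  rw [doublePerm_symm, halfTermOf, halfTermOf, chunkOf_doublePerm]
  have := mem_chunkSymmetries.1 ((chunkSymmetries τ).inv_mem hσ) (chunkOf p)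
  simpa [Equiv.Perm.inv_def] using this

/-- **The classes `S_{t,i',j',k'}` of a permuted triple are the translated classes.** [cite: VassilevskaWilliamsXuXuZhou2024, §6.3 and Def. 6.12 ("by symmetry between level-ℓ positions")] -/
theorem pairClass_actSeq {σ : Equiv.Perm (Fin n)} (hσ : σ ∈ chunkSymmetries τ) (I J K : Fin (n + n) → ℕ) (t : Fin s) (i j k : ℕ) :
    pairClass τ (actSeq σ I) (actSeq σ J) (actSeq σ K) t i j k = (pairClass τ I J K t i j k).map (doublePerm σ).toEmbedding := by
  ext p
  rw [mem_map_equiv, mem_pairClass, mem_pairClass, halfTermOf_doublePerm_symm τ hσ]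
  rfl

/-- The classes `S_{t,*,*,k'}` of a permuted block. [cite: VassilevskaWilliamsXuXuZhou2024, §6.3] -/
theorem pairClassZ_actSeq {σ : Equiv.Perm (Fin n)} (hσ : σ ∈ chunkSymmetries τ) (K : Fin (n + n) → ℕ) (t : Fin s) (k : ℕ) :
    pairClassZ τ (actSeq σ K) t k = (pairClassZ τ K t k).map (doublePerm σ).toEmbedding := by
  ext p
  rw [mem_map_equiv, mem_pairClassZ, mem_pairClassZ, halfTermOf_doublePerm_symm τ hσ]
  rfl

omit τ in
/-- Split distributions of a permuted sequence on a translated set of positions. [cite: VassilevskaWilliamsXuXuZhou2024, Def. 3.5] -/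
@[simp] theorem completeSplitOn_actSeq_map (σ : Equiv.Perm (Fin n)) (Wh : Fin (n + n) → Fin c → Fin 3) (S : Finset (Fin (n + n))) :
    completeSplitOn (actSeq σ Wh) (S.map (doublePerm σ).toEmbedding) = completeSplitOn Wh S := by
  have h := completeSplitOn_comp Wh (doublePerm σ).symm S
  rw [Equiv.symm_symm] at h
  exact h

/-- **Usefulness (Def. 6.11) is invariant under the chunk symmetries.** [cite: VassilevskaWilliamsXuXuZhou2024, Def. 6.11] -/
theorem isUsefulFor₂_actSeq_iff {σ : Equiv.Perm (Fin n)} (hσ : σ ∈ chunkSymmetries τ) (β : Fin s → ℕ × ℕ × ℕ → (Fin c → Fin 3) → ℝ)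
    (I J K : Fin (n + n) → ℕ) (Wh : Fin (n + n) → Fin c → Fin 3) :
    IsUsefulFor₂ τ β (actSeq σ I) (actSeq σ J) (actSeq σ K) (actSeq σ Wh) ↔ IsUsefulFor₂ τ β I J K Wh := by
  simp only [IsUsefulFor₂, pairClass_actSeq τ hσ, completeSplitOn_actSeq_map, map_nonempty]

/-- **Typicalness is invariant under the chunk symmetries.** [cite: VassilevskaWilliamsXuXuZhou2024, Def. 6.9 (second item)] -/
theorem isTypical₂_actSeq_iff {σ : Equiv.Perm (Fin n)} (hσ : σ ∈ chunkSymmetries τ) (L : Fin s → InterfaceTerm (c + c))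
    (w : Fin s → ℕ × ℕ × ℕ → ℝ) (βZ : Fin s → ℕ × ℕ × ℕ → (Fin c → Fin 3) → ℝ) (K : Fin (n + n) → ℕ) (Kh : Fin (n + n) → Fin c → Fin 3) :
    IsTypical₂ τ L w βZ (actSeq σ K) (actSeq σ Kh) ↔ IsTypical₂ τ L w βZ K Kh := by
  simp only [IsTypical₂, pairClassZ_actSeq τ hσ, completeSplitOn_actSeq_map, map_nonempty]

/-- **Compatibility (Def. 6.9) is invariant under the chunk symmetries.** [cite: VassilevskaWilliamsXuXuZhou2024, Def. 6.9 and Def. 6.12 ("by symmetry")] -/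
theorem isCompatibleWith₂_actSeq_iff {σ : Equiv.Perm (Fin n)} (hσ : σ ∈ chunkSymmetries τ) (L : Fin s → InterfaceTerm (c + c))
    (w : Fin s → ℕ × ℕ × ℕ → ℝ) (βZ : Fin s → ℕ × ℕ × ℕ → (Fin c → Fin 3) → ℝ) (I J K : Fin (n + n) → ℕ)
    (Kh : Fin (n + n) → Fin c → Fin 3) :
    IsCompatibleWith₂ τ L w βZ (actSeq σ I) (actSeq σ J) (actSeq σ K) (actSeq σ Kh) ↔ IsCompatibleWith₂ τ L w βZ I J K Kh := by
  simp only [IsCompatibleWith₂, pairClass_actSeq τ hσ, completeSplitOn_actSeq_map, map_nonempty,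
    isTypical₂_actSeq_iff τ hσ]

/-- The left classes of a permuted triple. [cite: VassilevskaWilliamsXuXuZhou2024, §6.6] -/
theorem leftClass_actSeq (σ : Equiv.Perm (Fin n)) (I J K : Fin (n + n) → ℕ) (t : Fin s) (hσ : σ ∈ chunkSymmetries τ) (i j k : ℕ) :
    leftClass τ (actSeq σ I) (actSeq σ J) (actSeq σ K) t i j k = (leftClass τ I J K t i j k).map σ.toEmbedding := by
  ext u
  rw [mem_map_equiv, mem_leftClass, mem_leftClass, actSeq_castAdd, actSeq_castAdd, actSeq_castAdd]
  have hτ : τ (σ.symm u) = τ u := by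
    have := mem_chunkSymmetries.1 ((chunkSymmetries τ).inv_mem hσ) u
    simpa [Equiv.Perm.inv_def] using this
  rw [hτ]

/-- **`{α_t}`-consistency is invariant under the chunk symmetries.** [cite: VassilevskaWilliamsXuXuZhou2024, §6.2] -/
theorem isAlphaTConsistent_actSeq_iff {σ : Equiv.Perm (Fin n)} (hσ : σ ∈ chunkSymmetries τ) (cnt : Fin s → ℕ × ℕ × ℕ → ℕ)
    (I J K : Fin (n + n) → ℕ) :
    IsAlphaTConsistent τ cnt (actSeq σ I) (actSeq σ J) (actSeq σ K) ↔ IsAlphaTConsistent τ cnt I J K := by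
  simp only [IsAlphaTConsistent, leftClass_actSeq τ σ I J K _ hσ, card_map]

omit τ in
/-- Blocks of permuted level-1 sequences. [folklore] -/
theorem blockOfSeq_actSeq (σ : Equiv.Perm (Fin n)) (Kh : Fin (n + n) → Fin c → Fin 3) :
    blockOfSeq (actSeq σ Kh) = actSeq σ (blockOfSeq Kh) := rfl

omit τ in
/-- `seqVal` commutes with the action. [folklore] -/
theorem seqVal_actSeq {P : ℕ} (σ : Equiv.Perm (Fin n)) (I : Fin (n + n) → Fin (P + 1)) :
    seqVal (actSeq σ I) = actSeq σ (seqVal I) := rfl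

end Equivariance

/-! ## Transitivity on the consistent triples; `C` and `V` are well defined -/

namespace ConstituentRegion

open scoped Classical

variable {c n s M : ℕ} {D : ConstituentRegion c n s M}

/-- The consistent triples are stable under the chunk symmetries. [cite: VassilevskaWilliamsXuXuZhou2024, §6.2] -/
theorem permTriple_mem_consistent {σ : Equiv.Perm (Fin n)} (hσ : σ ∈ chunkSymmetries D.τ)
    {T : (Fin (n + n) → Fin (2 * c + 1)) × (Fin (n + n) → Fin (2 * c + 1)) × (Fin (n + n) → Fin (2 * c + 1))}
    (hT : T ∈ D.consistent) : permTriple σ T ∈ D.consistent := by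
  obtain ⟨hTu, hcnt⟩ := mem_filter.1 hT
  refine mem_filter.2 ⟨permTriple_mem_tripleUniverse hσ hTu, ?_⟩
  show IsAlphaTConsistent D.τ D.cnt (seqVal (actSeq σ T.1)) (seqVal (actSeq σ T.2.1)) (seqVal (actSeq σ T.2.2))
  rw [seqVal_actSeq, seqVal_actSeq, seqVal_actSeq, isAlphaTConsistent_actSeq_iff D.τ hσ]
  exact hcnt

/-- **The chunk symmetries act transitively on the `{α_t}`-consistent triples** (inside the level-`ℓ`
blocks a triple is determined by its word of left split types `u ↦ (I,J,K)(left u)`, whose counts per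
term are `cnt t`). [cite: VassilevskaWilliamsXuXuZhou2024, Def. 6.12 ("By symmetry between level-ℓ positions")] -/
theorem exists_chunkSymm_permTriple_eq (hD : D.WellFormed)
    {T T' : (Fin (n + n) → Fin (2 * c + 1)) × (Fin (n + n) → Fin (2 * c + 1)) × (Fin (n + n) → Fin (2 * c + 1))}
    (hT : T ∈ D.consistent) (hT' : T' ∈ D.consistent) : ∃ σ ∈ chunkSymmetries D.τ, permTriple σ T = T' := by
  obtain ⟨hTu, hcnt⟩ := mem_filter.1 hT
  obtain ⟨hT'u, hcnt'⟩ := mem_filter.1 hT'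
  obtain ⟨-, hI, hJ, hK⟩ := tripleSet_good hD hTu
  obtain ⟨-, hI', hJ', hK'⟩ := tripleSet_good hD hT'u
  -- the words of left split types have the same counts
  set w : Fin n → Fin s × Fin (2 * c + 1) × Fin (2 * c + 1) × Fin (2 * c + 1) :=
    fun u => (D.τ u, T.1 (Fin.castAdd n u), T.2.1 (Fin.castAdd n u), T.2.2 (Fin.castAdd n u)) with hw
  set w' : Fin n → Fin s × Fin (2 * c + 1) × Fin (2 * c + 1) × Fin (2 * c + 1) :=
    fun u => (D.τ u, T'.1 (Fin.castAdd n u), T'.2.1 (Fin.castAdd n u), T'.2.2 (Fin.castAdd n u)) with hw'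
  have hleft : ∀ (T₀ : (Fin (n + n) → Fin (2 * c + 1)) × (Fin (n + n) → Fin (2 * c + 1)) × (Fin (n + n) → Fin (2 * c + 1)))
      (t : Fin s) (a b d : Fin (2 * c + 1)),
      (univ.filter fun u => (D.τ u, T₀.1 (Fin.castAdd n u), T₀.2.1 (Fin.castAdd n u), T₀.2.2 (Fin.castAdd n u)) = (t, a, b, d)).card =
        (leftClass D.τ (seqVal T₀.1) (seqVal T₀.2.1) (seqVal T₀.2.2) t a b d).card := by
    intro T₀ t a b d
    congr 1
    ext u
    simp only [mem_filter, mem_univ, true_and, mem_leftClass, Prod.mk.injEq, seqVal, Fin.ext_iff]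
  have htype : letterCount w = letterCount w' := by
    funext tabd
    obtain ⟨t, a, b, d⟩ := tabd
    rw [letterCount_apply, letterCount_apply, hw, hw', hleft T t a b d, hleft T' t a b d, hcnt t (a, b, d), hcnt' t (a, b, d)]
  obtain ⟨σ, hσ⟩ := exists_perm_of_letterCount_eq htype
  -- `hσ : ∀ m, w' (σ m) = w m`
  have hσmem : σ ∈ chunkSymmetries D.τ := mem_chunkSymmetries.2 fun u => congrArg Prod.fst (hσ u)
  have hσ' : σ.symm ∈ chunkSymmetries D.τ := (chunkSymmetries D.τ).inv_mem hσmem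
  have hτ : ∀ u, D.τ (σ.symm u) = D.τ u := fun u => mem_chunkSymmetries.1 hσ' u
  have hval : ∀ u, T'.1 (Fin.castAdd n u) = T.1 (Fin.castAdd n (σ.symm u)) ∧ T'.2.1 (Fin.castAdd n u) = T.2.1 (Fin.castAdd n (σ.symm u)) ∧
      T'.2.2 (Fin.castAdd n u) = T.2.2 (Fin.castAdd n (σ.symm u)) := by
    intro u
    have h := hσ (σ.symm u)
    rw [Equiv.apply_symm_apply] at h
    simp only [hw, hw', Prod.mk.injEq] at h
    exact ⟨h.2.1, h.2.2.1, h.2.2.2⟩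
  refine ⟨σ, hσmem, ?_⟩
  refine Prod.ext ?_ (Prod.ext ?_ ?_)
  · funext p
    refine Fin.addCases (motive := fun p => actSeq σ T.1 p = T'.1 p) (fun u => ?_) (fun u => ?_) p
    · rw [actSeq_castAdd, (hval u).1]
    · rw [actSeq_natAdd]
      apply Fin.ext
      have e := hI (σ.symm u); have e' := hI' u
      rw [hτ u] at e
      have h1 := congrArg Fin.val (hval u).1
      omega
  · funext p
    refine Fin.addCases (motive := fun p => actSeq σ T.2.1 p = T'.2.1 p) (fun u => ?_) (fun u => ?_) p
    · rw [actSeq_castAdd, (hval u).2.1]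
    · rw [actSeq_natAdd]
      apply Fin.ext
      have e := hJ (σ.symm u); have e' := hJ' u
      rw [hτ u] at e
      have h1 := congrArg Fin.val (hval u).2.1
      omega
  · funext p
    refine Fin.addCases (motive := fun p => actSeq σ T.2.2 p = T'.2.2 p) (fun u => ?_) (fun u => ?_) p
    · rw [actSeq_castAdd, (hval u).2.2]
    · rw [actSeq_natAdd]
      apply Fin.ext
      have e := hK (σ.symm u); have e' := hK' u
      rw [hτ u] at e
      have h1 := congrArg Fin.val (hval u).2.2
      omega

variable (D) in
/-- **`C(T)`**: the number of level-1 `Z`-blocks `Z_K̂ ∈ Z_K` compatible (Def. 6.9) with the triple `T`.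
[cite: VassilevskaWilliamsXuXuZhou2024, Claim 6.13 (proof, first quantity, per triple)] -/
def compatCount (T : (Fin (n + n) → Fin (2 * c + 1)) × (Fin (n + n) → Fin (2 * c + 1)) × (Fin (n + n) → Fin (2 * c + 1))) : ℕ :=
  (univ.filter fun Kh : Fin (n + n) → Fin c → Fin 3 => blockOfSeq Kh = T.2.2 ∧ D.toHashed.CZ T Kh).card

/-- Compatibility with a permuted triple. [cite: VassilevskaWilliamsXuXuZhou2024, Def. 6.9] -/
theorem cz_permTriple_actSeq_iff {σ : Equiv.Perm (Fin n)} (hσ : σ ∈ chunkSymmetries D.τ)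
    (T : (Fin (n + n) → Fin (2 * c + 1)) × (Fin (n + n) → Fin (2 * c + 1)) × (Fin (n + n) → Fin (2 * c + 1)))
    (Kh : Fin (n + n) → Fin c → Fin 3) : D.toHashed.CZ (permTriple σ T) (actSeq σ Kh) ↔ D.toHashed.CZ T Kh := by
  rw [toHashed_CZ, toHashed_CZ]
  show IsCompatibleWith₂ D.τ D.L _ D.βZ (seqVal (actSeq σ T.1)) (seqVal (actSeq σ T.2.1)) (seqVal (actSeq σ T.2.2)) (actSeq σ Kh) ↔ _
  rw [seqVal_actSeq, seqVal_actSeq, seqVal_actSeq, isCompatibleWith₂_actSeq_iff D.τ hσ]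

/-- Usefulness (`Z`) for a permuted triple. [cite: VassilevskaWilliamsXuXuZhou2024, Def. 6.11] -/
theorem uz_permTriple_actSeq_iff {σ : Equiv.Perm (Fin n)} (hσ : σ ∈ chunkSymmetries D.τ)
    (T : (Fin (n + n) → Fin (2 * c + 1)) × (Fin (n + n) → Fin (2 * c + 1)) × (Fin (n + n) → Fin (2 * c + 1)))
    (Kh : Fin (n + n) → Fin c → Fin 3) : D.toHashed.UZ (permTriple σ T) (actSeq σ Kh) ↔ D.toHashed.UZ T Kh := by
  rw [toHashed_UZ, toHashed_UZ]
  show IsUsefulFor₂ D.τ D.βZ (seqVal (actSeq σ T.1)) (seqVal (actSeq σ T.2.1)) (seqVal (actSeq σ T.2.2)) (actSeq σ Kh) ↔ _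
  rw [seqVal_actSeq, seqVal_actSeq, seqVal_actSeq, isUsefulFor₂_actSeq_iff D.τ hσ]

/-- **`C` does not depend on the consistent triple** ("by symmetry"). [cite: VassilevskaWilliamsXuXuZhou2024, Claim 6.13 (proof) and Def. 6.12] -/
theorem compatCount_eq (hD : D.WellFormed)
    {T T' : (Fin (n + n) → Fin (2 * c + 1)) × (Fin (n + n) → Fin (2 * c + 1)) × (Fin (n + n) → Fin (2 * c + 1))}
    (hT : T ∈ D.consistent) (hT' : T' ∈ D.consistent) : D.compatCount T = D.compatCount T' := by
  obtain ⟨σ, hσ, he⟩ := exists_chunkSymm_permTriple_eq hD hT hT'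
  refine card_nbij' (actSeq σ) (actSeq σ.symm) (fun Kh hKh => ?_) (fun Kh hKh => ?_)
    (fun Kh _ => actSeq_symm_actSeq σ Kh) (fun Kh _ => actSeq_actSeq_symm σ Kh)
  · have h := mem_filter.1 (mem_coe.1 hKh)
    refine mem_coe.2 (mem_filter.2 ⟨mem_univ _, ?_, ?_⟩)
    · rw [blockOfSeq_actSeq, h.2.1, ← he]; rfl
    · rw [← he, cz_permTriple_actSeq_iff hσ]; exact h.2.2
  · have h := mem_filter.1 (mem_coe.1 hKh)
    have hσ' : σ.symm ∈ chunkSymmetries D.τ := (chunkSymmetries D.τ).inv_mem hσ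
    have he' : permTriple σ.symm T' = T := by rw [← he, permTriple_symm_permTriple]
    refine mem_coe.2 (mem_filter.2 ⟨mem_univ _, ?_, ?_⟩)
    · rw [blockOfSeq_actSeq, h.2.1, ← he']; rfl
    · rw [← he', cz_permTriple_actSeq_iff hσ']; exact h.2.2

variable (D) in
/-- **The `K̂'` with the same level-`ℓ` complete split distributions `{ξ_{Z,t}}` as `K̂` on every term**
(the same counts of (left shape, right shape) pairs over the chunks of each term). [cite: VassilevskaWilliamsXuXuZhou2024, Def. 6.12 ("K̂ has level-ℓ complete split distributions {ξ_{Z,t}}")] -/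
def shapeClass (Kh : Fin (n + n) → Fin c → Fin 3) : Finset (Fin (n + n) → Fin c → Fin 3) :=
  pairTypeClass D.τ fun t a => countOn (classOf D.τ t) (halfPairs Kh) a

/-- `K̂` lies in its own class. [folklore] -/
theorem mem_shapeClass_self (Kh : Fin (n + n) → Fin c → Fin 3) : Kh ∈ D.shapeClass Kh := mem_pairTypeClass_self D.τ Kh

variable (D) in
/-- **The `{α_t}`-consistent triples through `Z_K` compatible with `K̂ ∈ Z_K`** (their number `V(K̂)` is
`p*_comp · numalpha / numzblock`). [cite: VassilevskaWilliamsXuXuZhou2024, Def. 6.12 and Claim 6.15] -/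
def compatTriples (Kh : Fin (n + n) → Fin c → Fin 3) :
    Finset ((Fin (n + n) → Fin (2 * c + 1)) × (Fin (n + n) → Fin (2 * c + 1)) × (Fin (n + n) → Fin (2 * c + 1))) :=
  D.consistent.filter fun T' => T'.2.2 = blockOfSeq Kh ∧ D.toHashed.CZ T' Kh

/-- **Def. 6.12 is well posed**: `V(K̂)` only depends on the level-`ℓ` complete split distributions of `K̂`
("By symmetry between level-ℓ positions, this probability is the same for different K̂ that have the same
complete split distributions"). [cite: VassilevskaWilliamsXuXuZhou2024, Def. 6.12] -/
theorem card_compatTriples_eq_of_mem_shapeClass {Kh Kh' : Fin (n + n) → Fin c → Fin 3} (hKh' : Kh' ∈ D.shapeClass Kh) :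
    (D.compatTriples Kh').card = (D.compatTriples Kh).card := by
  obtain ⟨σ, hσ, he⟩ := exists_chunkSymm_of_mem_pairTypeClass D.τ (mem_shapeClass_self Kh) hKh'
  have hσ' : σ.symm ∈ chunkSymmetries D.τ := (chunkSymmetries D.τ).inv_mem hσ
  have he' : actSeq σ.symm Kh' = Kh := by rw [← he, actSeq_symm_actSeq]
  symm
  refine card_nbij' (permTriple σ) (permTriple σ.symm) (fun T hT => ?_) (fun T hT => ?_)
    (fun T _ => permTriple_symm_permTriple σ T) (fun T _ => permTriple_permTriple_symm σ T)
  · have h := mem_filter.1 (mem_coe.1 hT)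
    refine mem_coe.2 (mem_filter.2 ⟨permTriple_mem_consistent hσ h.1, ?_, ?_⟩)
    · show actSeq σ T.2.2 = blockOfSeq Kh'
      rw [h.2.1, ← blockOfSeq_actSeq, he]
    · rw [← he, cz_permTriple_actSeq_iff hσ]; exact h.2.2
  · have h := mem_filter.1 (mem_coe.1 hT)
    refine mem_coe.2 (mem_filter.2 ⟨permTriple_mem_consistent hσ' h.1, ?_, ?_⟩)
    · show actSeq σ.symm T.2.2 = blockOfSeq Kh
      rw [h.2.1, ← blockOfSeq_actSeq, he']
    · rw [← he', cz_permTriple_actSeq_iff hσ']; exact h.2.2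

/-- **VXXZ Claim 6.13 as an exact double count**: `V(K̂) · #{K̂' : ξ(K̂') = ξ(K̂)} ≤ numalpha · C` — the
pairs (consistent triple, compatible `K̂'` of the class of `K̂` in its `Z`-block) number
`#class · V(K̂)` by the symmetry, and are among ALL pairs (consistent triple, compatible `K̂'` in its
`Z`-block), which number `numalpha · C` ("We dropped the condition of having correct level-ℓ complete
split distributions and got an overestimation"). [cite: VassilevskaWilliamsXuXuZhou2024, Claim 6.13 (proof)] -/
theorem card_compatTriples_mul_card_shapeClass_le (hD : D.WellFormed)
    {T₀ : (Fin (n + n) → Fin (2 * c + 1)) × (Fin (n + n) → Fin (2 * c + 1)) × (Fin (n + n) → Fin (2 * c + 1))}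
    (hT₀ : T₀ ∈ D.consistent) (Kh : Fin (n + n) → Fin c → Fin 3) :
    (D.compatTriples Kh).card * (D.shapeClass Kh).card ≤ D.consistent.card * D.compatCount T₀ := by
  -- the pairs `(K̂', T')` with `K̂'` in the class and `T'` compatible through its block
  set P₁ := (D.shapeClass Kh ×ˢ D.consistent).filter fun p => p.2.2.2 = blockOfSeq p.1 ∧ D.toHashed.CZ p.2 p.1 with hP₁
  set P₂ := ((univ : Finset (Fin (n + n) → Fin c → Fin 3)) ×ˢ D.consistent).filter
    fun p => p.2.2.2 = blockOfSeq p.1 ∧ D.toHashed.CZ p.2 p.1 with hP₂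
  have h1 : P₁.card = (D.shapeClass Kh).card * (D.compatTriples Kh).card := by
    rw [card_eq_sum_card_fiberwise (f := Prod.fst) (s := P₁) (t := D.shapeClass Kh)
      (fun p hp => (mem_product.1 (mem_filter.1 hp).1).1)]
    rw [← Finset.sum_const_nat (m := (D.compatTriples Kh).card) (f := fun Kh' => (P₁.filter fun p => p.1 = Kh').card)]
    intro Kh' hKh'
    rw [← card_compatTriples_eq_of_mem_shapeClass hKh']
    refine card_nbij' Prod.snd (fun T' => (Kh', T')) (fun p hp => ?_) (fun T' hT' => ?_) (fun p hp => ?_) (fun T' _ => rfl)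
    · have hp' := mem_filter.1 (mem_coe.1 hp)
      have hq := mem_filter.1 hp'.1
      refine mem_coe.2 (mem_filter.2 ⟨(mem_product.1 hq.1).2, ?_, ?_⟩)
      · rw [← hp'.2]; exact hq.2.1
      · rw [← hp'.2]; exact hq.2.2
    · have h := mem_filter.1 (mem_coe.1 hT')
      exact mem_coe.2 (mem_filter.2 ⟨mem_filter.2 ⟨mem_product.2 ⟨hKh', h.1⟩, h.2.1, h.2.2⟩, rfl⟩)
    · have hp' := mem_filter.1 (mem_coe.1 hp)
      exact Prod.ext hp'.2.symm rfl
  have h2 : P₂.card = D.consistent.card * D.compatCount T₀ := by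
    rw [card_eq_sum_card_fiberwise (f := Prod.snd) (s := P₂) (t := D.consistent)
      (fun p hp => (mem_product.1 (mem_filter.1 hp).1).2)]
    rw [← Finset.sum_const_nat (m := D.compatCount T₀) (f := fun T' => (P₂.filter fun p => p.2 = T').card)]
    intro T' hT'
    rw [← compatCount_eq hD hT' hT₀, compatCount]
    refine card_nbij' Prod.fst (fun Kh' => (Kh', T')) (fun p hp => ?_) (fun Kh' hKh' => ?_) (fun p hp => ?_) (fun Kh' _ => rfl)
    · have hp' := mem_filter.1 (mem_coe.1 hp)
      have hq := mem_filter.1 hp'.1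
      refine mem_coe.2 (mem_filter.2 ⟨mem_univ _, ?_, ?_⟩)
      · rw [← hp'.2]; exact hq.2.1.symm
      · rw [← hp'.2]; exact hq.2.2
    · have h := mem_filter.1 (mem_coe.1 hKh')
      exact mem_coe.2 (mem_filter.2 ⟨mem_filter.2 ⟨mem_product.2 ⟨mem_univ _, hT'⟩, h.2.1.symm, h.2.2⟩, rfl⟩)
    · have hp' := mem_filter.1 (mem_coe.1 hp)
      exact Prod.ext rfl hp'.2.symm
  have hsub : P₁ ⊆ P₂ := by
    intro p hp
    have hp' := mem_filter.1 hp
    exact mem_filter.2 ⟨mem_product.2 ⟨mem_univ _, (mem_product.1 hp'.1).2⟩, hp'.2⟩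
  calc (D.compatTriples Kh).card * (D.shapeClass Kh).card = P₁.card := by rw [h1, mul_comm]
    _ ≤ P₂.card := card_le_card hsub
    _ = D.consistent.card * D.compatCount T₀ := h2

/-- **`U_A(T) ≤ ∑_{K̂ ∈ A useful} V(K̂)`** (Claim 6.15's proof: each hole pair `(K̂, T')` has `T'` among the
consistent triples through `Z_K` compatible with `K̂`). [cite: VassilevskaWilliamsXuXuZhou2024, Claim 6.15 (proof)] -/
theorem card_holePairsIn_le (A : Finset (Fin (n + n) → Fin c → Fin 3))
    (T : (Fin (n + n) → Fin (2 * c + 1)) × (Fin (n + n) → Fin (2 * c + 1)) × (Fin (n + n) → Fin (2 * c + 1))) :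
    (D.toHashed.holePairsIn A T).card ≤
      ∑ Kh ∈ A.filter (fun Kh => blockOfSeq Kh = T.2.2 ∧ D.toHashed.UZ T Kh), (D.compatTriples Kh).card := by
  rw [HashedZeroOut.holePairsIn, HashedZeroOut.holePairs, filter_filter,
    card_eq_sum_card_fiberwise (f := Prod.fst) (t := A.filter fun Kh => blockOfSeq Kh = T.2.2 ∧ D.toHashed.UZ T Kh)
      (fun q hq => by
        obtain ⟨-, ⟨hb, hu, -⟩, hA⟩ := mem_filter.1 hq
        exact mem_filter.2 ⟨hA, hb, hu⟩)]
  refine sum_le_sum fun Kh hKh => ?_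
  refine card_le_card_of_injOn (fun q => q.2) (fun q hq => ?_) (fun q₁ h₁ q₂ h₂ heq => ?_)
  · rw [mem_coe, mem_filter] at hq
    obtain ⟨hq, hq1⟩ := hq
    obtain ⟨hq𝒯, ⟨hb, -, -, hK, hc⟩, -⟩ := mem_filter.1 hq
    rw [mem_coe, compatTriples, mem_filter]
    refine ⟨(mem_product.1 hq𝒯).2, ?_, ?_⟩
    · rw [hK, ← hb, hq1]
    · rw [← hq1]; exact hc
  · rw [mem_coe, mem_filter] at h₁ h₂
    exact Prod.ext (h₁.2.trans h₂.2.symm) heq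

variable (D) in
/-- **`M_Z(T)`**: the number of level-1 `Z`-sequences in `Z_K` useful for `T` (the level-1 `Z`-blocks of
`𝒯*_T`). [cite: VassilevskaWilliamsXuXuZhou2024, §6.5 (𝒯*) and Cor. 4.2 (M_Z)] -/
def usefulZCount (T : (Fin (n + n) → Fin (2 * c + 1)) × (Fin (n + n) → Fin (2 * c + 1)) × (Fin (n + n) → Fin (2 * c + 1))) : ℕ :=
  (univ.filter fun Kh : Fin (n + n) → Fin c → Fin 3 => blockOfSeq Kh = T.2.2 ∧ D.toHashed.UZ T Kh).card

/-- **`U_A(T) · m ≤ M_Z(T) · numalpha · C`** whenever every relevant useful `K̂` has a class of size `≥ m`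
(Claims 6.13 and 6.15 combined: `U_A(T) ≤ ∑_{K̂} V(K̂) ≤ M_Z(T) · max V` and `V · #class ≤ numalpha · C`).
[cite: VassilevskaWilliamsXuXuZhou2024, Claim 6.13 and Claim 6.15] -/
theorem card_holePairsIn_mul_le (hD : D.WellFormed) (A : Finset (Fin (n + n) → Fin c → Fin 3))
    {T T₀ : (Fin (n + n) → Fin (2 * c + 1)) × (Fin (n + n) → Fin (2 * c + 1)) × (Fin (n + n) → Fin (2 * c + 1))}
    (hT₀ : T₀ ∈ D.consistent) {m : ℕ}
    (hm : ∀ Kh ∈ A, blockOfSeq Kh = T.2.2 → D.toHashed.UZ T Kh → m ≤ (D.shapeClass Kh).card) :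
    (D.toHashed.holePairsIn A T).card * m ≤ D.usefulZCount T * (D.consistent.card * D.compatCount T₀) := by
  set U := A.filter fun Kh => blockOfSeq Kh = T.2.2 ∧ D.toHashed.UZ T Kh with hU
  have hUle : U.card ≤ D.usefulZCount T := by
    refine card_le_card fun Kh hKh => ?_
    have h := mem_filter.1 hKh
    exact mem_filter.2 ⟨mem_univ _, h.2⟩
  calc (D.toHashed.holePairsIn A T).card * m ≤ (∑ Kh ∈ U, (D.compatTriples Kh).card) * m :=
        Nat.mul_le_mul_right _ (card_holePairsIn_le A T)
    _ = ∑ Kh ∈ U, (D.compatTriples Kh).card * m := by rw [sum_mul]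
    _ ≤ ∑ Kh ∈ U, (D.compatTriples Kh).card * (D.shapeClass Kh).card := by
        refine sum_le_sum fun Kh hKh => Nat.mul_le_mul_left _ ?_
        have h := mem_filter.1 hKh
        exact hm Kh h.1 h.2.1 h.2.2
    _ ≤ ∑ _Kh ∈ U, D.consistent.card * D.compatCount T₀ :=
        sum_le_sum fun Kh _ => card_compatTriples_mul_card_shapeClass_le hD hT₀ Kh
    _ = U.card * (D.consistent.card * D.compatCount T₀) := by rw [sum_const, smul_eq_mul]
    _ ≤ D.usefulZCount T * (D.consistent.card * D.compatCount T₀) := Nat.mul_le_mul_right _ hUle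

end ConstituentRegion

end Literature.Computability.AlgebraicComplexity
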